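import Literature.MathematicalPhysics.QuantumFieldTheory.Balaban1983to89.B9Eq3105FamThreeCommStepAtDatum
import Literature.MathematicalPhysics.QuantumFieldTheory.Balaban1983to89.B9Eq3105FamThreeCommStepAdjAtDatum

/-!
# `Balaban1983to89.B9Eq3105FamThreeCommStepsAtDatum` — FAMILY 3 OF (3.105): THE TWO CUBE-SIDE COMMUTATOR LETTERS `hR □` (p21 D3's order,
# `(M_{χ_□}Δ′_{a,□} − Δ′_{a,□}M_{χ_□})·G′_□`) AND `hT □` (the adjoint order, `G′_□·(Δ′_{a,□}M_{χ_□} − M_{χ_□}Δ′_{a,□})`) AT THE (3.35) DATUM `Ṽ_□` BEHIND ONE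
# ∃-PACKAGE — p33 E2e `commStep_at_datum` ∧ p38 E3c `commStepAdj_at_datum` under a COMMON `(δ, θ, M₀, T₀, N₀, a₁)` (min ∕ max bookkeeping only, p21 D6's pattern), so
# that the family-3 assembler displays both letters behind a single existential (sub-row G-B9-LETTERS, GAPS G-B9-05 ∕ G-B9-p33-01, programme FAMTHREE FILE F3-E3f;
# lead g35 GO 06:13Z 2026-08-29; seat p38 gen 48)

T. Bałaban, *Propagators for lattice gauge theories in a background field*, Commun. Math. Phys. **99** (1985) 389–434 [`Balaban1985BackgroundPropagators`, "[B9]"];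
[4] = T. Bałaban, *Propagators and renormalization transformations for lattice gauge theories. II*, Commun. Math. Phys. **96** (1984) 223–250 [`Balaban1984PropagatorsII`].

statement-level skeleton of published theorems with citation tags; proofs where landed; nothing here is a claim about the Yang–Mills mass gap

THE PRINTED LOCUS (held `paper:balaban1985-cmp99-background-propagators`, journal page = PDF page + 388).  (3.88)–(3.89) p. 409 (the commutator letters of the
third sum of (3.105) p. 414; p. 415 l. 26–37); Cor. 3.6 p. 408 («U′ = U^u = e^{iηA}», the localised field); Thm 3.1 (3.42) p. 397; Thm 3.4 p. 400; (3.24)–(3.25)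
p. 394; (3.59) p. 402; [4] (2.51)–(2.52) p. 232, (2.46) p. 231, p. 247.

WHY THIS FILE.  The two located `G′`-difference entries of family 3 are supplied (p33 E2d `hasMajorant_hDL_chiL_of_eBlock`, p38 E3c `hasMajorant_hDR_at_of_cube`)
from two CUBE-SIDE letters at the datum `Ṽ_□ = locCfgY i □ η_k A`: `hR □` — `conj b(((M_{χ_□}Δ′_{a,□}(Ṽ_□) − Δ′_{a,□}(Ṽ_□)M_{χ_□})·G′_□(Ṽ_□))^ℝ) ≺ θ_R·e^{−δ_Rd_□}`,
∃-packaged over all members above one threshold by p33 E2e `B9Eq3105FamThreeCommStepAtDatum.commStep_at_datum` — and `hT □` — `conj b((G′_□(Ṽ_□)·(Δ′_{a,□}(Ṽ_□)M_{χ_□}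
− M_{χ_□}Δ′_{a,□}(Ṽ_□)))^ℝ) ≺ θ_T·e^{−δ_Td_□}`, ∃-packaged by p38 E3c `B9Eq3105FamThreeCommStepAdjAtDatum.commStepAdj_at_datum` —, each with its own `(δ, θ)` and
thresholds `(M₀, T₀, N₀, a₁)`.  Both records of family 3 (`hrest`: p33 FILE 7 + p38 `…AtLocCfgOfTailsClosed`; `hV′`: p38 `B9Eq3105FamThreeRecordsD1Closed`) display
BOTH letters.  THIS FILE merges the two packages into ONE: `δ := min δ_R δ_T`, `θ := max θ_R θ_T`, `M₀, T₀, N₀ := max`, `a₁ := min`, and weakens each kernel to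
`θ·e^{−δd_□}` (`d_□ ≥ 0`, `B9CubeGeometryInputs.geoCK_dist_axioms`).  Nothing else.

WHAT THIS FILE CERTIFIES (kernel-checked; 0 `def`, 0 `def … : Prop`, 0 sorry; standard axioms only)
* `kernel_weaken` — `θ ≤ θ′`, `δ′ ≤ δ`, `0 ≤ θ′`, `0 ≤ t` ⟹ `θ·e^{−δt} ≤ θ′·e^{−δ′t}`.
* ★★ `commSteps_at_datum` — ∃ `δ > 0`, `θ ≥ 0`, thresholds `M₀, T₀, N₀`, `a₁ > 0` (functions of `d, L`, the basis datum `M₂, Σ‖b_j‖`) such that for every member above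
  the thresholds, every cover cube `□`, all `Rr, H`, every gauge `g`, field `U` and (3.35) cube datum `(A, Q, C, ξ, Λ)` with `α₁ ≤ a₁, 1∕4` (the SAME binder prefix
  as E2e ∕ E3c): `IsUnit Δ′_{a,□}(Ṽ_□)` ∧ `hR □` with kernel `θ·e^{−δd_□}` ∧ `hT □` with kernel `θ·e^{−δd_□}`, over `(toB6 (geoCK i □) Rr H, blkCubeY)`.

HONEST SCOPE ∕ NOT CLAIMED.  Min ∕ max bookkeeping over two landed ∃-packages (E2e, E3c) — no new inequality of [B9]; `𝔸` with `‖1‖ = 1` (as in E2e ∕ E3c).  The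
records' other displayed data (`hE`∕`hEO`∕`hCinv`, the units on the member, `η = |c_f|⁻¹`, the (3.35) data, FILE 6's words, transfers, (2.61)'s, budgets) are
untouched; the ∃-elimination at the assembler is the assembler's.  Count-neutral; NOT a node discharge; no summit ∕ sub-problem statement is proved; nothing
continuum ∕ OS ∕ mass-gap ∕ Clay; YM mass gap NOT proved (Track A conditional rung).  No `sorry`, no `axiom`, no `… : Prop` fact, no `instance`, no `notation`, no
`def`.  NEW file; nothing landed is modified.  Cell `lit-balaban`, seat `lit-balaban-p38` gen 48, 2026-08-29; `--supports stmt-QuantumFields-19200`.  Net new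
unproved facts: 0.

RELATED IN THE TREE, NOT DUPLICATED (searched 2026-08-29: `rg 'commSteps_at_datum|CommStepsAtDatum' Literature/` = nothing): p33 E2e `B9Eq3105FamThreeCommStepAtDatum`,
p38 E3c `B9Eq3105FamThreeCommStepAdjAtDatum` (USED BY NAME), p21 D6 `B9ThmDAtDatum` (the max ∕ min threshold pattern followed).
-/

noncomputable section

namespace Literature.MathematicalPhysics.QuantumFieldTheory.Balaban1983to89.B9Eq3105FamThreeCommStepsAtDatum

open NormedSpace Complex
open B6RandomWalk (HasMajorant hasMajorant_mono)
open B9Thm34Ext (toB6)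
open B9Eq352DivFormLetters (conj)
open B9Eq39Adjoint (fluct covD)
open B9Eq360DeltaPrimeAY (AfldY)
open B9Eq360DeltaPrimeACubeY (blkCubeY)
open B6KLevelCensusIndexV1 (KIdx kGeo)
open B6Cover236MultiLevelBlocks (cubes)
open B6GlobalChartV1 (PV boxEquiv)
open B9BackgroundsKLevelV1 (shiftsV1)
open B9CubeGeometryInputs (geoCK RM1 geoCK_dist_axioms)
open B9CubeLettersOpsL0 (deltaPrimeACubeY GpCubeY)
open B9Cor36CubeCutoffs (SC NearC chiY locCfgY)
open B9Thm37CubeCoverCommutators (cutMulY)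
open B9Eq3105FamThreeCommStepAtDatum (commStep_at_datum)
open B9Eq3105FamThreeCommStepAdjAtDatum (commStepAdj_at_datum)
open B4PartitionUnity22 (thetaProf D1)
open Node00 (SiteY CfgY GaugeY toKT parSymY gaugeY)

variable {𝔸 : Type} [NormedRing 𝔸] [NormedAlgebra ℂ 𝔸] [CompleteSpace 𝔸]
variable {ι : Type} [Fintype ι]

/-- Kernel bookkeeping: `θ ≤ θ′`, `δ′ ≤ δ`, `0 ≤ θ′`, `0 ≤ t` ⟹ `θ·e^{−δt} ≤ θ′·e^{−δ′t}` (elementary monotonicity; the kernel shape is [4] (2.51)'s, nothing of [4]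
is claimed). [cite: Balaban1984PropagatorsII, (2.51)–(2.52) p.232 (kernel shape only)] -/
theorem kernel_weaken {θ θ' δ δ' t : ℝ} (hθ : θ ≤ θ') (hδ : δ' ≤ δ) (hθ' : 0 ≤ θ') (ht : 0 ≤ t) :
    θ * Real.exp (-(δ * t)) ≤ θ' * Real.exp (-(δ' * t)) :=
  mul_le_mul hθ (Real.exp_le_exp.2 (neg_le_neg (mul_le_mul_of_nonneg_right hδ ht))) (Real.exp_nonneg _) hθ'

section Datum

variable [NormOneClass 𝔸] [DecidableEq ι] (b : Module.Basis ι ℝ 𝔸)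

set_option maxHeartbeats 1600000 in
/-- ★★ **BOTH CUBE-SIDE COMMUTATOR LETTERS OF FAMILY 3 AT THE (3.35) DATUM, ONE ∃-PACKAGE**: ∃ `δ > 0`, `θ ≥ 0`, thresholds `M₀, T₀, N₀` and Thm 3.4's `a₁ > 0` such that
for every member above the thresholds, every cover cube `□`, all `Rr, H`, every gauge `g`, field `U` and (3.35) cube datum `(A, Q, C, ξ, Λ)` with
`α₁ = max C (C(1+D₁θ))Λ² ≤ a₁, 1∕4`: `IsUnit Δ′_{a,□}(Ṽ_□)`, `conj b(((M_{χ_□}Δ′_{a,□}(Ṽ_□) − Δ′_{a,□}(Ṽ_□)M_{χ_□})·G′_□(Ṽ_□))^ℝ) ≺ θ·e^{−δd_□}` (p33 E2e's `hR □`) and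
`conj b((G′_□(Ṽ_□)·(Δ′_{a,□}(Ṽ_□)M_{χ_□} − M_{χ_□}Δ′_{a,□}(Ṽ_□)))^ℝ) ≺ θ·e^{−δd_□}` (p38 E3c's `hT □`) over `(toB6 (geoCK i □) Rr H, blkCubeY)`, `Ṽ_□ = locCfgY i □ η_k A`;
`δ = min(δ_R, δ_T)`, `θ = max(θ_R, θ_T)`, thresholds the max ∕ min of E2e's and E3c's.
[cite: Balaban1985BackgroundPropagators, (3.88)–(3.89) p.409, Cor. 3.6 p.408, Thm 3.1 (3.42) p.397, Thm 3.4 p.400, (3.24)–(3.25) p.394, (3.59) p.402; Balaban1984PropagatorsII, (2.51)–(2.52) p.232, (2.46) p.231, p.247] -/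
theorem commSteps_at_datum (d ℓ : ℕ) (hℓ : 1 ≤ ℓ) {M₂ : ℝ} (hM₂ : 0 ≤ M₂) (hrepr : ∀ (v : 𝔸) (j : ι), |b.repr v j| ≤ M₂ * ‖v‖) :
    ∃ δS θS M₀ T₀ : ℝ, ∃ N₀ : ℕ, 0 < δS ∧ 0 ≤ θS ∧ ∃ a₁ : ℝ, 0 < a₁ ∧
    ∀ {hd : 1 ≤ d + 1} {hL : Odd (ℓ + 1) ∧ 1 < ℓ + 1} {b₀ b₁ : ℝ} (i : KIdx d ℓ hd hL b₀ b₁) (c : ↥(cubes (toKT i).D.toDomains)) (Rr : ℝ) (H : Prop),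
      M₀ ≤ ((ℓ : ℝ) + 1) * (toKT i).Mh → N₀ + 1 ≤ (toKT i).R * ((ℓ + 1) * (toKT i).Mh) → T₀ ≤ RM1 i →
    ∀ (g : GaugeY 𝔸 i) (U : CfgY 𝔸 i) (A : AfldY 𝔸 i) (Q : Set (Site (PV d ℓ i.m i.K hd hL) 0)) (C ξ Λ : ℝ),
      0 ≤ C → 0 < ξ → 1 ≤ Λ → ξ ≤ 5 * (SC i c : ℝ) * (kGeo i).eta → LatticeNorms.scaleLen ((ℓ : ℝ) + 1) (kGeo i).eta (c.1.1 + 1) ≤ Λ * ξ →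
      (∀ x : Site (PV d ℓ i.m i.K hd hL) 0, NearC i c (35 * SC i c / 8 + 1) (boxEquiv i.hN x).1 → x ∈ Q) →
      (∀ (κ : Fin (d + 1)) (x : Site (PV d ℓ i.m i.K hd hL) 0), x ∈ Q → x.shift κ ∈ Q → gaugeY i g U κ x = fluct (kGeo i).eta A κ x) →
      (∀ κ, ∀ x ∈ Q, ‖A κ x‖ ≤ C * ξ⁻¹) →
      (∀ μ ν, ∀ x ∈ Q, ‖(((kGeo i).eta : ℂ)⁻¹) • covD (shiftsV1 (PV d ℓ i.m i.K hd hL)) (fun _ _ => (1 : 𝔸ˣ)) μ (A ν) x‖ ≤ C * (ξ ^ 2)⁻¹) →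
      max C (C * (1 + D1 thetaProf)) * Λ ^ 2 ≤ a₁ → max C (C * (1 + D1 thetaProf)) * Λ ^ 2 ≤ 1 / 4 →
      IsUnit (deltaPrimeACubeY i c (parSymY i) (locCfgY i c (kGeo i).eta A)) ∧
      HasMajorant (g := toB6 (geoCK i c) Rr H) (fun p : SiteY i × ι => blkCubeY i c p.1)
        (conj b (((cutMulY (𝔸 := 𝔸) (chiY i c) * deltaPrimeACubeY i c (parSymY i) (locCfgY i c (kGeo i).eta A) -
            deltaPrimeACubeY i c (parSymY i) (locCfgY i c (kGeo i).eta A) * cutMulY (𝔸 := 𝔸) (chiY i c)) *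
          GpCubeY i c (parSymY i) (locCfgY i c (kGeo i).eta A)).restrictScalars ℝ))
        (fun a a' => θS * Real.exp (-(δS * (geoCK i c).dist a a'))) ∧
      HasMajorant (g := toB6 (geoCK i c) Rr H) (fun p : SiteY i × ι => blkCubeY i c p.1)
        (conj b ((GpCubeY i c (parSymY i) (locCfgY i c (kGeo i).eta A) *
            (deltaPrimeACubeY i c (parSymY i) (locCfgY i c (kGeo i).eta A) * cutMulY (𝔸 := 𝔸) (chiY i c) -
              cutMulY (𝔸 := 𝔸) (chiY i c) * deltaPrimeACubeY i c (parSymY i) (locCfgY i c (kGeo i).eta A))).restrictScalars ℝ))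
        (fun a a' => θS * Real.exp (-(δS * (geoCK i c).dist a a'))) := by
  obtain ⟨δR, θR, M₀R, T₀R, N₀R, hδR, hθR, a₁R, ha₁R, HR⟩ := commStep_at_datum b d ℓ hℓ hM₂ hrepr
  obtain ⟨δT, θT, M₀T, T₀T, N₀T, hδT, hθT, a₁T, ha₁T, HT⟩ := commStepAdj_at_datum b d ℓ hℓ hM₂ hrepr
  refine ⟨min δR δT, max θR θT, max M₀R M₀T, max T₀R T₀T, max N₀R N₀T, lt_min hδR hδT, le_max_of_le_left hθR, min a₁R a₁T, lt_min ha₁R ha₁T, ?_⟩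
  intro hd hL b₀ b₁ i c Rr H hM hN hT g U A Q C ξ Λ hC0 hξ hΛ hξS hΛξ hQ hgA hAf hdA hα₁ hα4
  obtain ⟨hunit, hRm⟩ := HR i c Rr H ((le_max_left _ _).trans hM) (le_trans (Nat.succ_le_succ (le_max_left _ _)) hN) ((le_max_left _ _).trans hT)
    g U A Q C ξ Λ hC0 hξ hΛ hξS hΛξ hQ hgA hAf hdA (hα₁.trans (min_le_left _ _)) hα4
  obtain ⟨-, hTm⟩ := HT i c Rr H ((le_max_right _ _).trans hM) (le_trans (Nat.succ_le_succ (le_max_right _ _)) hN) ((le_max_right _ _).trans hT)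
    g U A Q C ξ Λ hC0 hξ hΛ hξS hΛξ hQ hgA hAf hdA (hα₁.trans (min_le_right _ _)) hα4
  obtain ⟨hdnn, -, -, -⟩ := geoCK_dist_axioms i c Rr H
  have hθS : 0 ≤ max θR θT := le_max_of_le_left hθR
  exact ⟨hunit,
    hasMajorant_mono (g := toB6 (geoCK i c) Rr H) _ hRm fun a a' => kernel_weaken (le_max_left _ _) (min_le_left _ _) hθS (hdnn a a'),
    hasMajorant_mono (g := toB6 (geoCK i c) Rr H) _ hTm fun a a' => kernel_weaken (le_max_right _ _) (min_le_right _ _) hθS (hdnn a a')⟩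

end Datum

end Literature.MathematicalPhysics.QuantumFieldTheory.Balaban1983to89.B9Eq3105FamThreeCommStepsAtDatum

end
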